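import Literature.Computability.AlgebraicComplexity.GlobalStageHoles
import Literature.Computability.AlgebraicComplexity.InterfaceRelabel
import HarnessLib

/-!
# The global stage, region 1, assembled in exact form: the power restricts to independent copies
of the interface tensor `𝒯*` (Vassilevska Williams–Xu–Xu–Zhou 2024, Prop. 5.1 / §5.6–§5.7, one region) — proved

Topic `Literature/Computability/AlgebraicComplexity`.  Vassilevska Williams–Xu–Xu–Zhou (SODA 2024,
arXiv:2307.07970), end of §5.6: "… overall, `𝒯'''` contains `numalpha · M^{-1-o(1)}` copies of `𝒯*`
whose fraction of holes is `1/8N`.  By Cor. 4.2, we can degenerate them into `numalpha · M^{-1-o(1)}`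
unbroken copies of `𝒯*`" — the first region of **Proposition 5.1** ("`(CW_q^{⊗2^{ℓ-1}})^{⊗n}` can be
degenerated into `2^{(A₁E₁+A₂E₂+A₃E₃)n - o(n)}` independent copies of a level-`ℓ` interface tensor …").
This file PROVES the assembly in EXACT (non-asymptotic) form, for the data `D` of one region
(`GlobalStageStructure.lean`) and a seed `ω`:

* `summand_restrictsTo_refCopy` — the copy of `𝒯*` over a present triple `T` restricts to the broken
  copy, over any reference `α`-consistent triple `T₀`, of `𝒯*_{T₀}` with a hole set of the same size
  (relabelling the chunks, `InterfaceRelabel.lean`);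
* `power_restrictsTo_copies` — **for every `k, r` with `k · r ≤ #{T ∈ 𝒯'(ω) | |holes_ω T| ≤ h}`,
  `r ≥ 8^{3⌊log_{2N} 3^N⌋+3}` (`N = cn`) and `8 N h ≤ M_Z` (the number of level-1 `Z`-blocks of `𝒯*`):
  `(CW_q^{⊗c})^{⊗n} ≥ ⟨k⟩ ⊗ 𝒯*`** — zero-outs to `𝒯'''` (`GlobalStageStructure.lean`), the direct-sum
  decomposition, `k` batches of `r` good broken copies, and Cor. 4.2 (`vxxz2024_cor42`) on each batch;
* `vxxz2024_prop51_region` — combined with the good seed of `GlobalStageHoles.lean`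
  (`exists_seed_many_good_copies`): under the requirements on `M` (cleanup and holes),
  `(CW_q^{⊗c})^{⊗n} ≥ ⟨⌊|B| |𝒯α| / (2 M² r)⌋⟩ ⊗ 𝒯*` for every reference triple — the printed count
  `numalpha · |B| · (3/4) · M^{-2}` of surviving copies divided by the `r = 2^{O(N/log N)}` of Cor. 4.2,
  i.e. `numalpha · M₀^{-1-o(1)}` copies (Behrend's `|B| = M^{1-o(1)}`, `M ≤ 2M₀`).

Everything is proved; no new definitions besides the abbreviation `goodTriples`; no named facts.
The three-region product (§5.1, §5.7) and the asymptotic exponents `E_r` are not treated here.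

## References

* V. Vassilevska Williams, Y. Xu, Z. Xu, R. Zhou, *New bounds for matrix multiplication: from alpha
  to omega*, SODA 2024, arXiv:2307.07970 (held: `paper:arxiv-2307.07970`): Prop. 5.1, §5.6 (last
  paragraph), §5.7 (Summary), Cor. 4.2. [VassilevskaWilliamsXuXuZhou2024]
-/

noncomputable section

open scoped BigOperators
open Finset

namespace Literature.Computability.AlgebraicComplexity

open Literature.Barriers.MatrixMultiplication (bigCwTensor)

namespace GlobalStageData

open scoped Classical

universe u

variable {c n M : ℕ} (D : GlobalStageData c n M)

/-- **The good copies**: present triples whose copy of `𝒯*` has at most `h` holes. [cite: VassilevskaWilliamsXuXuZhou2024, §5.6 ("copies of 𝒯* whose fraction of holes does not exceed 1/8N")] -/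
abbrev goodTriples (ω : VxxzSeed M n) (h : ℕ) :
    Finset ((Fin n → Fin (2 * c + 1)) × (Fin n → Fin (2 * c + 1)) × (Fin n → Fin (2 * c + 1))) :=
  (D.present ω).filter fun T => (D.holes ω T).card ≤ h

/-- The interface tensor `𝒯*_T` over a block triple of `𝒯` (the useful sub-tensor, Claim 5.11).
[cite: VassilevskaWilliamsXuXuZhou2024, Claim 5.11] -/
abbrev starTensor (R : Type u) [CommSemiring R] (q : ℕ)
    (T : (Fin n → Fin (2 * c + 1)) × (Fin n → Fin (2 * c + 1)) × (Fin n → Fin (2 * c + 1))) :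
    (Fin n → Fin c → Fin (q + 2)) → (Fin n → Fin c → Fin (q + 2)) → (Fin n → Fin c → Fin (q + 2)) → R :=
  usefulSubtensor R q (seqVal T.1) (seqVal T.2.1) (seqVal T.2.2) D.γX D.γY D.γZ

/-- The number `M_Z` of level-1 `Z`-blocks of `𝒯*_T` (useful `Z`-sequences in `Z_K`). [cite: VassilevskaWilliamsXuXuZhou2024, Cor. 4.2 (M_Z) and Claim 5.11] -/
abbrev usefulZCount (T : (Fin n → Fin (2 * c + 1)) × (Fin n → Fin (2 * c + 1)) × (Fin n → Fin (2 * c + 1))) : ℕ :=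
  (univ.filter fun Kh : Fin n → Fin c → Fin 3 => blockOfSeq Kh = T.2.2 ∧ D.UsefulZ T Kh).card

variable {D}

/-! ## Relabelling a copy onto the reference copy -/

/-- **Every copy restricts to a broken reference copy with as many holes**: for `α`-consistent block
triples `T, T₀` and any hole set `H` of level-1 `Z`-sequences, the broken copy of `𝒯*_T` with holes `H`
restricts to the broken copy of `𝒯*_{T₀}` with a hole set of the same cardinality (transport the
holes along the chunk permutation relating the two term maps).
[cite: VassilevskaWilliamsXuXuZhou2024, §5.6 ("copies of 𝒯*") and Def. 4.1] -/
theorem brokenCopy_restrictsTo_refCopy (hD : D.WellFormed) (R : Type u) [CommSemiring R] (q : ℕ)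
    {T T₀ : (Fin n → Fin (2 * c + 1)) × (Fin n → Fin (2 * c + 1)) × (Fin n → Fin (2 * c + 1))}
    (hT : T ∈ D.𝒯α) (hT₀ : T₀ ∈ D.𝒯α) (H : Finset (Fin n → Fin c → Fin 3)) :
    ∃ H₀ : Finset (Fin n → Fin c → Fin 3), H₀.card = H.card ∧
      TensorRestrictsTo (partSubtensor levelSeq levelSeq levelSeq (D.starTensor R q T) univ univ Hᶜ)
        (partSubtensor levelSeq levelSeq levelSeq (D.starTensor R q T₀) univ univ H₀ᶜ) := by
  have hlev := isLevelTriple_of_mem_tripleSet (hD.subset hT)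
  have hlev₀ := isLevelTriple_of_mem_tripleSet (hD.subset hT₀)
  -- the two term maps have the same types, hence `τ_{T} ∘ σ = τ_{T₀}` for a permutation `σ`
  have htype := letterCount_tripleTermMap_eq_of_isAlphaConsistent hlev₀ hlev
    (hD.alphaConsistent _ hT₀) (hD.alphaConsistent _ hT)
  obtain ⟨σ, hσ⟩ := exists_perm_of_letterCount_eq htype
  -- `hσ : ∀ m, tripleTermMap hlev (σ m) = tripleTermMap hlev₀ m`, i.e. `τ_T = τ_{T₀} ∘ σ⁻¹`
  have hτ : tripleTermMap hlev = tripleTermMap hlev₀ ∘ ⇑σ.symm := by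
    funext v
    have := hσ (σ.symm v)
    simp only [Equiv.apply_symm_apply] at this
    simp only [Function.comp_apply]
    exact this
  refine ⟨H.image (chunkPerm σ.symm), card_image_of_injective _ (chunkPerm σ.symm).injective, ?_⟩
  have hcancel : ∀ w : Fin n → Fin c → Fin 3, chunkPerm σ.symm (chunkPerm σ w) = w := by
    intro w; funext u; simp
  have hcancel' : ∀ w : Fin n → Fin c → Fin 3, chunkPerm σ (chunkPerm σ.symm w) = w := by
    intro w; funext u; simp
  -- the broken reference copy is the broken copy read through `chunkPerm σ`
  have key : partSubtensor levelSeq levelSeq levelSeq (D.starTensor R q T₀) univ univ (H.image (chunkPerm σ.symm))ᶜ =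
      fun x y z => partSubtensor levelSeq levelSeq levelSeq (D.starTensor R q T) univ univ Hᶜ
        (chunkPerm σ x) (chunkPerm σ y) (chunkPerm σ z) := by
    funext x y z
    simp only [starTensor, usefulSubtensor_eq_interfaceTensor R q hlev, usefulSubtensor_eq_interfaceTensor R q hlev₀,
      partSubtensor_apply, mem_univ, true_and, mem_compl, hτ, interfaceTensor_relabel, levelSeq_chunkPerm]
    congr 1
    apply propext
    rw [mem_image]
    constructor
    · rintro hno hmem
      exact hno ⟨chunkPerm σ (levelSeq z), hmem, hcancel _⟩
    · rintro hno ⟨K, hK, hKe⟩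
      apply hno
      have : chunkPerm σ (levelSeq z) = K := by rw [← hKe, hcancel']
      rw [this]; exact hK
  rw [key]
  exact TensorRestrictsTo.comap _ _ _ _

/-- The number of useful `Z`-sequences of a block triple of `𝒯` is the number `M_Z` of level-1
`Z`-blocks of its interface tensor `𝒯*_T`. [cite: VassilevskaWilliamsXuXuZhou2024, Claim 5.11 and Cor. 4.2] -/
theorem usefulZCount_eq_card_levelBlocksZ
    {T : (Fin n → Fin (2 * c + 1)) × (Fin n → Fin (2 * c + 1)) × (Fin n → Fin (2 * c + 1))}
    (hT : T ∈ D.tripleSet) :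
    D.usefulZCount T = (levelBlocksZ (tripleTermMap (isLevelTriple_of_mem_tripleSet hT))
      (tripleTermList c D.γX D.γY D.γZ) 0).card := by
  unfold usefulZCount
  congr 1
  ext Kh
  rw [mem_filter, mem_levelBlocksZ_triple_iff, chunkLevels_eq_iff]
  simp [UsefulZ]

/-- **The power restricts to `k` independent copies of `𝒯*`** (§5.6, last paragraph, in exact form):
if `k · r ≤ #{T ∈ 𝒯'(ω) | |holes_ω T| ≤ h}`, `r ≥ 8^{3⌊log_{2N} 3^N⌋+3}` (`N = cn`, the count of Cor. 4.2)
and `8 N h ≤ M_Z(T)` for the `α`-consistent triples, then for every reference `T₀ ∈ 𝒯α`,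
`(CW_q^{⊗c})^{⊗n} ≥ ⟨k⟩ ⊗ 𝒯*_{T₀}` — zero-out to `𝒯'''`, decompose into the copies over the present
triples, keep `k` batches of `r` good copies, relabel each onto `T₀` and fix its holes by Cor. 4.2.
[cite: VassilevskaWilliamsXuXuZhou2024, §5.6 ("By Cor. 4.2, we can degenerate them into numalpha·M^{-1-o(1)} unbroken copies of 𝒯*") and Prop. 5.1] -/
theorem power_restrictsTo_copies (hD : D.WellFormed) (R : Type u) [CommSemiring R] (q : ℕ)
    (hc : 0 < c) (hn : 0 < n) (ω : VxxzSeed M n) {h k r : ℕ}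
    (hr : 8 ^ (3 * Nat.log (2 * (c * n)) (3 ^ (c * n)) + 3) ≤ r)
    (hkr : k * r ≤ (D.goodTriples ω h).card)
    (hh : ∀ T ∈ D.𝒯α, 8 * (c * n) * h ≤ D.usefulZCount T)
    {T₀ : (Fin n → Fin (2 * c + 1)) × (Fin n → Fin (2 * c + 1)) × (Fin n → Fin (2 * c + 1))}
    (hT₀ : T₀ ∈ D.𝒯α) :
    TensorRestrictsTo (kroneckerPow (kroneckerPow (bigCwTensor R q) c) n)
      (kroneckerTensor (unitTensor R k) (D.starTensor R q T₀)) := by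
  have hlev₀ := isLevelTriple_of_mem_tripleSet (hD.subset hT₀)
  -- (1) zero-out to `𝒯'''` and (2) the direct sum over the present triples
  have h1 : TensorRestrictsTo (kroneckerPow (kroneckerPow (bigCwTensor R q) c) n) (D.finalTensor R q ω) :=
    tensorRestrictsTo_partSubtensor _ _ _ _ _ _ _
  have h2 := finalTensor_restrictsTo_directSum hD R q ω
  -- (3) `k · r` good copies, indexed by `Fin k × Fin r`
  set g := (D.goodTriples ω h).card with hg
  let eg : Fin g ≃ ↥(D.goodTriples ω h) := (Fintype.equivFinOfCardEq (Fintype.card_coe _)).symm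
  have hgood_sub : D.goodTriples ω h ⊆ D.present ω := filter_subset _ _
  let j : Fin k × Fin r → ↥(D.goodTriples ω h) := fun p => eg (Fin.castLE hkr (finProdFinEquiv p))
  have hj : Function.Injective j := fun p p' hpp' =>
    finProdFinEquiv.injective (Fin.castLE_injective hkr (eg.injective hpp'))
  let ι : Fin k × Fin r → ↥(D.present ω) := fun p => ⟨(j p).1, hgood_sub (j p).2⟩
  have hι : Function.Injective ι := by
    intro p p' hpp'
    have h' : (ι p).1 = (ι p').1 := congrArg Subtype.val hpp'
    exact hj (Subtype.ext (show (j p).1 = (j p').1 from h'))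
  have hιgood : ∀ p, (ι p).1 ∈ D.goodTriples ω h := fun p => (j p).2
  have h3 : TensorRestrictsTo (familyDirectSum fun T : ↥(D.present ω) => D.summand R q ω T)
      (familyDirectSum fun p : Fin k × Fin r => D.summand R q ω (ι p)) :=
    familyDirectSum_reindex _ hι
  have h4 : TensorRestrictsTo (familyDirectSum fun p : Fin k × Fin r => D.summand R q ω (ι p))
      (familyDirectSum fun a : Fin k => familyDirectSum fun b : Fin r => D.summand R q ω (ι (a, b))) :=
    familyDirectSum_prod fun a b => D.summand R q ω (ι (a, b))
  -- (4) each copy restricts to a broken reference copy with at most `h` holes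
  have hcopy : ∀ (a : Fin k) (b : Fin r), ∃ H₀ : Finset (Fin n → Fin c → Fin 3), H₀.card ≤ h ∧
      TensorRestrictsTo (D.summand R q ω (ι (a, b)))
        (partSubtensor levelSeq levelSeq levelSeq (D.starTensor R q T₀) univ univ H₀ᶜ) := by
    intro a b
    have hgd := hιgood (a, b)
    obtain ⟨hpres, hholes⟩ := mem_filter.1 hgd
    have hTα : (ι (a, b)).1 ∈ D.𝒯α := presentTriples_subset hpres
    obtain ⟨H₀, hcard, hres⟩ := brokenCopy_restrictsTo_refCopy hD R q hTα hT₀ (D.holes ω (ι (a, b)).1)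
    refine ⟨H₀, hcard ▸ hholes, ?_⟩
    rw [summand_eq_brokenCopy hD R q (ι (a, b))]
    exact hres
  choose H₀ hH₀card hH₀ using hcopy
  -- (5) Cor. 4.2 on each batch
  have hbatch : ∀ a : Fin k, TensorRestrictsTo (familyDirectSum fun b : Fin r => D.summand R q ω (ι (a, b)))
      (D.starTensor R q T₀) := by
    intro a
    refine (familyDirectSum_mono fun b => hH₀ a b).trans ?_
    have hstar : D.starTensor R q T₀ =
        interfaceTensor R q (tripleTermMap hlev₀) (tripleTermList c D.γX D.γY D.γZ) 0 :=
      usefulSubtensor_eq_interfaceTensor R q hlev₀ _ _ _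
    have e1 : (fun b : Fin r => partSubtensor levelSeq levelSeq levelSeq (D.starTensor R q T₀) univ univ (H₀ a b)ᶜ) =
        fun b : Fin r => partSubtensor levelSeq levelSeq levelSeq
          (interfaceTensor R q (tripleTermMap hlev₀) (tripleTermList c D.γX D.γY D.γZ) 0)
          ((fun _ : Fin r => (∅ : Finset (Fin n → Fin c → Fin 3))) b)ᶜ
          ((fun _ : Fin r => (∅ : Finset (Fin n → Fin c → Fin 3))) b)ᶜ (H₀ a b)ᶜ := by
      funext b
      rw [hstar, compl_empty]
    rw [e1, hstar]
    refine vxxz2024_cor42 R q hc hn (tripleTermMap hlev₀) (tripleTermList c D.γX D.γY D.γZ)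
      (fun _ => ∅) (fun _ => ∅) (H₀ a) (fun _ => by simp) (fun _ => by simp) (fun b => ?_) hr
    calc 8 * (c * n) * (H₀ a b).card ≤ 8 * (c * n) * h := Nat.mul_le_mul_left _ (hH₀card a b)
      _ ≤ D.usefulZCount T₀ := hh T₀ hT₀
      _ = _ := usefulZCount_eq_card_levelBlocksZ (hD.subset hT₀)
  have h5 : TensorRestrictsTo
      (familyDirectSum fun a : Fin k => familyDirectSum fun b : Fin r => D.summand R q ω (ι (a, b)))
      (kroneckerTensor (unitTensor R k) (D.starTensor R q T₀)) := by
    rw [← familyDirectSum_const]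
    exact familyDirectSum_mono hbatch
  exact h1.trans (h2.trans (h3.trans (h4.trans h5)))

variable [Fact M.Prime]

/-- **VXXZ Proposition 5.1, one region, exact form.**  Let `D` be well-formed data of the first
region (`GlobalStageStructure.lean`), `M` an odd prime with `2c < M`, `n, c ≥ 1`, `B ⊆ ℤ/M` without
non-trivial 3-term progressions, and assume the requirements on `M` of §5.2 and §5.6 in counting form:
`8|𝒯| ≤ M |typeClass μX|`, `8|𝒯| ≤ M |typeClass μY|` and, for every `T ∈ 𝒯α`,
`10 U(T) M^{n-1} ≤ h M^n` (`h ≥ 1`) together with the hole budget `8 N h ≤ M_Z(T)` of Cor. 4.2.  Then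
for every `r ≥ 8^{3⌊log_{2N} 3^N⌋+3}` and every reference triple `T₀ ∈ 𝒯α`,
`(CW_q^{⊗c})^{⊗n} ≥ ⟨⌊|B| |𝒯α| / (2 M² r)⌋⟩ ⊗ 𝒯*_{T₀}` (a good seed exists, `exists_seed_many_good_copies`,
and witnesses the restriction) — the printed "`numalpha · M^{-1-o(1)}` unbroken
copies of `𝒯*`" with all constants explicit (`𝒯*_{T₀}` is the level-`ℓ` interface tensor with
parameter list `{(|S_{i,j,k}|, i, j, k, γ_{X,i,j,k}, γ_{Y,i,j,k}, γ_{Z,i,j,k})}`, `usefulSubtensor_eq_interfaceTensor`).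
(If `𝒯α = ∅` the count is `0` and the statement is void; the three-region product and the asymptotic
exponents are not part of this statement.) [cite: VassilevskaWilliamsXuXuZhou2024, Prop. 5.1 and §5.6–§5.7] -/
theorem vxxz2024_prop51_region (hD : D.WellFormed) (R : Type u) [CommSemiring R] (q : ℕ)
    (hM : M ≠ 2) (hcM : 2 * c < M) (hc : 0 < c) (hn : 0 < n) (hB : ThreeAPFree (D.B : Set (ZMod M)))
    (h8X : 8 * D.tripleSet.card ≤ M * (typeClass n D.μX).card)
    (h8Y : 8 * D.tripleSet.card ≤ M * (typeClass n D.μY).card) {h : ℕ} (hh1 : 0 < h)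
    (hU : ∀ T ∈ D.𝒯α, 10 * ((D.holePairs T).card * M ^ (n - 1)) ≤ h * M ^ n)
    (hh : ∀ T ∈ D.𝒯α, 8 * (c * n) * h ≤ D.usefulZCount T) {r : ℕ}
    (hr : 8 ^ (3 * Nat.log (2 * (c * n)) (3 ^ (c * n)) + 3) ≤ r)
    {T₀ : (Fin n → Fin (2 * c + 1)) × (Fin n → Fin (2 * c + 1)) × (Fin n → Fin (2 * c + 1))}
    (hT₀ : T₀ ∈ D.𝒯α) :
    TensorRestrictsTo (kroneckerPow (kroneckerPow (bigCwTensor R q) c) n)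
      (kroneckerTensor (unitTensor R (D.B.card * D.𝒯α.card / (2 * M ^ 2 * r))) (D.starTensor R q T₀)) := by
  obtain ⟨ω, hω⟩ := exists_seed_many_good_copies hD hM hcM hn hB h8X h8Y hh1 hU
  refine power_restrictsTo_copies hD R q hc hn ω hr ?_ hh hT₀
  -- `⌊|B||𝒯α| / (2M²r)⌋ · r ≤ #good`
  rcases Nat.eq_zero_or_pos r with rfl | hrpos
  · simp
  have hMpos : 0 < M := Nat.Prime.pos Fact.out
  have h2M : 0 < 2 * M ^ 2 := by positivity
  calc D.B.card * D.𝒯α.card / (2 * M ^ 2 * r) * r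
      = D.B.card * D.𝒯α.card / (2 * M ^ 2) / r * r := by rw [Nat.div_div_eq_div_mul]
    _ ≤ D.B.card * D.𝒯α.card / (2 * M ^ 2) := Nat.div_mul_le_self _ _
    _ ≤ (D.goodTriples ω h).card := by
        rw [Nat.div_le_iff_le_mul_add_pred h2M]
        exact hω.trans (Nat.le_add_right _ _)

/-- **VXXZ Proposition 5.1, one region, exact form — threshold `h+1`** (as
`vxxz2024_prop51_region`, with the hole requirement `10 U(T) M^{n-1} ≤ (h+1) M^n` and no positivity
assumption on `h`, via `exists_seed_many_good_copies'`). [cite: VassilevskaWilliamsXuXuZhou2024, Prop. 5.1 and §5.6–§5.7] -/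
theorem vxxz2024_prop51_region' (hD : D.WellFormed) (R : Type u) [CommSemiring R] (q : ℕ)
    (hM : M ≠ 2) (hcM : 2 * c < M) (hc : 0 < c) (hn : 0 < n) (hB : ThreeAPFree (D.B : Set (ZMod M)))
    (h8X : 8 * D.tripleSet.card ≤ M * (typeClass n D.μX).card)
    (h8Y : 8 * D.tripleSet.card ≤ M * (typeClass n D.μY).card) {h : ℕ}
    (hU : ∀ T ∈ D.𝒯α, 10 * ((D.holePairs T).card * M ^ (n - 1)) ≤ (h + 1) * M ^ n)
    (hh : ∀ T ∈ D.𝒯α, 8 * (c * n) * h ≤ D.usefulZCount T) {r : ℕ}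
    (hr : 8 ^ (3 * Nat.log (2 * (c * n)) (3 ^ (c * n)) + 3) ≤ r)
    {T₀ : (Fin n → Fin (2 * c + 1)) × (Fin n → Fin (2 * c + 1)) × (Fin n → Fin (2 * c + 1))}
    (hT₀ : T₀ ∈ D.𝒯α) :
    TensorRestrictsTo (kroneckerPow (kroneckerPow (bigCwTensor R q) c) n)
      (kroneckerTensor (unitTensor R (D.B.card * D.𝒯α.card / (2 * M ^ 2 * r))) (D.starTensor R q T₀)) := by
  obtain ⟨ω, hω⟩ := exists_seed_many_good_copies' hD hM hcM hn hB h8X h8Y hU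
  refine power_restrictsTo_copies hD R q hc hn ω hr ?_ hh hT₀
  rcases Nat.eq_zero_or_pos r with rfl | hrpos
  · simp
  have hMpos : 0 < M := Nat.Prime.pos Fact.out
  have h2M : 0 < 2 * M ^ 2 := by positivity
  calc D.B.card * D.𝒯α.card / (2 * M ^ 2 * r) * r
      = D.B.card * D.𝒯α.card / (2 * M ^ 2) / r * r := by rw [Nat.div_div_eq_div_mul]
    _ ≤ D.B.card * D.𝒯α.card / (2 * M ^ 2) := Nat.div_mul_le_self _ _
    _ ≤ (D.goodTriples ω h).card := by
        rw [Nat.div_le_iff_le_mul_add_pred h2M]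
        exact hω.trans (Nat.le_add_right _ _)

end GlobalStageData

end Literature.Computability.AlgebraicComplexity
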